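import Mathlib
import HarnessLib
import Summits.HubbardSuperconductivity.HubbardSuperconductivity.Theorems.WeakCouplingBCSKlCertTPrimeTorusSublevel
import Summits.HubbardSuperconductivity.HubbardSuperconductivity.Theorems.WeakCouplingBCSKlCertTPrimePocketConvexGeom
import Summits.HubbardSuperconductivity.HubbardSuperconductivity.Theorems.WeakCouplingBCSKlCertTPm03HSTransport

/-!
# Route `WeakCouplingBCS` — certificate half of stmt-HubbardSuperconductivity-0158, item (N3)′ of «TPRIME-LINDHARD-HS» (pen (R475)(A)), file F4:
# (N3)′ DISCHARGED at the reflected Γ-pocket of the `(⅛, −0.3)` cell ⇒ the `χ₀` HILBERT–SCHMIDT ROW IS A THEOREM ⇒ the two `t′ = −3/10` records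
# MODULO THEIR CERTIFIED ENCLOSURES ONLY

Cell `gate-hubbard-kl`, seat p4 (g24); zero kit; no definitions.  Composition of the generic (TSL) `kltp_exists_torusSublevel_le` (F3b; β = 1/2, any
`0 < curvNum` chart whose image exhausts the level set mod `2π`) with margin-1 g18's cell bricks (G1) `kltp_curvNum_pos_p03_polar` (strict convexity of the
Γ-pocket of `ε_{+3/10}` at `μ′ ∈ [9/10, 1]`, from `KlTPrimeConvexity.Mside_curvNum_neg` through the particle–hole map) and (G2) `kltp_exists_angle_of_level`
(✓ `…KlCertTPrimePocketConvexGeom`), then margin-1's assemblies ✓ `kltp_p03_HS_of_TSL` / `kltp_m03_HS_of_reflected_TSL` and record closers (✓ `…KlCertTPm03HSTransport`,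
✓ `…KlCertB1gTPm03D0125JointChi0Sup`):

* `kltp_TSL_p03` — **(N3)′**: the torus sublevel estimate for `ε_{3/10}` at every `μ′ ∈ [9/10, 1]` along `kltpPolar (3/10) μ′`, `β = 1/2`;
* `kltp_p03_HS`, **`kltp_m03_HS`** — the Hilbert–Schmidt rows `χ₀[ε_{±3/10}](· + ·) ∈ L²(σ ⊗ σ)` at `μ′ ∈ [9/10, 1]` resp. `μ ∈ [−1, −9/10]` (⊃ the record's box),
  UNCONDITIONAL — the `hHS` binder of the records, character for character;
* **`klCertB1gTPm03D0125_dominates_of_E (hE)`** (`γ = 33811/2²⁰`), **`klCertB1gTPm03D0125_dominatesJ_of_E (hE)`** (`γ_J = 88361/2²⁰`) and their `U = 1` forms: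
  `KLB1gDominatesTP (−3/10) mub mua γ(_J)` MODULO THE CERTIFIED ENCLOSURES `hE` ONLY — the same standing as the `t′ = 0` records.

HONEST LABEL: the two `(⅛, −0.3)` records stay RECORD-class (the enclosures (E4)/(E-J) are certified numerics outside Lean, entering as the hypothesis
`hE`); their ANALYTIC residual is now EMPTY.  Nothing DECIDED moves (W3′ +0.0435); nothing about other cells, `K₃`, `U₀`, the window or superconductivity; a
Kohn–Luttinger `O(U²)` channel statement is not ODLRO; nothing here proves superconductivity in the Hubbard model.
References: S. Raghu, S. A. Kivelson, D. J. Scalapino, Phys. Rev. B 81 (2010) 224505, §II (5)–(8), §III Fig. 3; E. M. Stein, *Harmonic Analysis* (1993),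
Ch. VIII §1.
-/

noncomputable section

-- the tree's namespace `Summit.<Summit>.<Problem>.Theorems` repeats the summit name by design (D-0017)
set_option linter.dupNamespace false

namespace Summit.HubbardSuperconductivity.HubbardSuperconductivity.Theorems

open Real Set Filter MeasureTheory KlCertTPrimeJoint Literature.MathematicalPhysics.QuantumLattice KlTPrimeConvexity
open scoped Topology ENNReal NNReal

/-! ### §1 (N3)′ at the reflected Γ-pocket -/

/-- **(N3)′ — THE TORUS SUBLEVEL ESTIMATE AT THE REFLECTED Γ-POCKET OF THE `(⅛, −0.3)` CELL**: for every `μ′ ∈ [9/10, 1]` there are `C ≥ 0` and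
`β = 1/2 ∈ (0, 2)` with `λ²⌞(−π,π]² {(θ, θ′) : |ε_{3/10}(p + γθ + γθ′) − μ′| < s} ≤ C·s^β` for all `p` and all `s > 0`, `γ = kltpPolar (3/10) μ′`
(strict convexity (G1) + chart exhaustiveness (G2) feed the generic `kltp_exists_torusSublevel_le`). [cite: SteinHarmonicAnalysis1993, Ch. VIII §1] -/
theorem kltp_TSL_p03 {μ' : ℝ} (hμ1 : 9 / 10 ≤ μ') (hμ2 : μ' ≤ 1) :
    ∃ C β : ℝ, 0 ≤ C ∧ 0 < β ∧ β < 2 ∧ ∀ (p : Momentum) (s : ℝ), 0 < s →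
      ((volume.restrict (Ioc (-π) π)).prod (volume.restrict (Ioc (-π) π)))
        {z : ℝ × ℝ | |squareDispersion 1 (3 / 10) (p + (kltpPolar (3 / 10) μ' z.1 + kltpPolar (3 / 10) μ' z.2)) - μ'| < s} ≤
        ENNReal.ofReal (C * s ^ β) := by
  have htp : |(3 / 10 : ℝ)| < 1 / 2 := by rw [abs_of_pos (by norm_num : (0:ℝ) < 3 / 10)]; norm_num
  have hμ₁ : -4 - 4 * (3 / 10 : ℝ) < μ' := by linarith
  have hμ₂ : μ' < 4 * (3 / 10 : ℝ) := by linarith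
  refine kltp_exists_torusSublevel_le htp hμ₁ hμ₂ (fun θ => ?_) (fun X Y h => kltp_exists_angle_of_level htp hμ₁ hμ₂ h)
  have h := kltp_curvNum_pos_p03_polar hμ1 hμ2 θ
  rwa [kltpPolar_apply_zero', kltpPolar_apply_one'] at h

/-! ### §2 The Hilbert–Schmidt rows, unconditional -/

/-- **The Hilbert–Schmidt row at the reflected Γ-cell**: `χ₀[ε_{+3/10}](· + ·; μ′) ∈ L²(σ ⊗ σ)` for every `μ′ ∈ [9/10, 1]`. [cite: RaghuKivelsonScalapino2010, §II (5)-(8)] -/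
theorem kltp_p03_HS {μ' : ℝ} (hμ1 : 9 / 10 ≤ μ') (hμ2 : μ' ≤ 1) :
    MemLp (fun z : Momentum × Momentum => lindhardFunction (squareDispersion 1 (3 / 10)) μ' (z.1 + z.2)) 2
      ((fermiCurveMeasure (squareDispersion 1 (3 / 10)) μ').prod (fermiCurveMeasure (squareDispersion 1 (3 / 10)) μ')) := by
  obtain ⟨C, β, hC, hβ0, hβ2, hTSL⟩ := kltp_TSL_p03 hμ1 hμ2
  exact kltp_p03_HS_of_TSL hμ1 hμ2 hC hβ0 hβ2 hTSL

/-- **THE `χ₀` HILBERT–SCHMIDT ROW OF THE `(⅛, −0.3)` CELL IS A THEOREM**: `χ₀[ε_{−3/10}](· + ·; μ) ∈ L²(σ ⊗ σ)` for every `μ ∈ [−1, −9/10]` (⊃ the record's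
μ-box) — the records' `hHS` binder, character for character, with NO hypothesis. [cite: RaghuKivelsonScalapino2010, §II (5)-(8)] -/
theorem kltp_m03_HS {μ : ℝ} (hμ1 : -1 ≤ μ) (hμ2 : μ ≤ -9 / 10) :
    MemLp (fun z : Momentum × Momentum => lindhardFunction (squareDispersion 1 (-3 / 10)) μ (z.1 + z.2)) 2
      ((fermiCurveMeasure (squareDispersion 1 (-3 / 10)) μ).prod (fermiCurveMeasure (squareDispersion 1 (-3 / 10)) μ)) := by
  obtain ⟨C, β, hC, hβ0, hβ2, hTSL⟩ := kltp_TSL_p03 (μ' := -μ) (by linarith) (by linarith)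
  exact kltp_m03_HS_of_reflected_TSL hμ1 hμ2 hC hβ0 hβ2 hTSL

/-! ### §3 The two `(⅛, −0.3)` records MODULO THEIR ENCLOSURES ONLY -/

/-- **The (δ) record `klCertB1gTPm03D0125` by `γ = 33811/2²⁰` MODULO ITS CERTIFIED ENCLOSURES (E4) ONLY** (analytic residual empty).
[cite: RaghuKivelsonScalapino2010, §III Fig. 3] -/
theorem klCertB1gTPm03D0125_dominates_of_E (hE : klCertB1gTPm03D0125.EnclosuresB1gTP (-3 / 10)) :
    KLB1gDominatesTP (-3 / 10) ((klCertB1gTPm03D0125.mub : ℚ) : ℝ) ((klCertB1gTPm03D0125.mua : ℚ) : ℝ)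
      ((klCertB1gTPm03D0125.gamma : ℚ) : ℝ) :=
  klCertB1gTPm03D0125_dominates_of_HS (fun bx hbx μ hμ =>
    kltp_m03_HS (klCertB1gTPm03D0125_box_mem' bx hbx μ hμ).1 (klCertB1gTPm03D0125_box_mem' bx hbx μ hμ).2) hE

/-- The `U = 1` form: `KLB1gDominatesAtTP (−3/10) mub mua γ` MODULO (E4) ONLY. [cite: RaghuKivelsonScalapino2010, §III Fig. 3] -/
theorem klCertB1gTPm03D0125_dominatesAt_of_E (hE : klCertB1gTPm03D0125.EnclosuresB1gTP (-3 / 10)) :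
    KLB1gDominatesAtTP (-3 / 10) ((klCertB1gTPm03D0125.mub : ℚ) : ℝ) ((klCertB1gTPm03D0125.mua : ℚ) : ℝ)
      ((klCertB1gTPm03D0125.gamma : ℚ) : ℝ) :=
  klCertB1gTPm03D0125_dominatesAt_of_HS (fun bx hbx μ hμ =>
    kltp_m03_HS (klCertB1gTPm03D0125_box_mem' bx hbx μ hμ).1 (klCertB1gTPm03D0125_box_mem' bx hbx μ hμ).2) hE

/-- **The JOINT record by `γ_J = 88361/2²⁰` MODULO ITS JOINT ENCLOSURES (E-J) ONLY** (analytic residual empty). [cite: RaghuKivelsonScalapino2010, §III Fig. 3] -/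
theorem klCertB1gTPm03D0125_dominatesJ_of_E (hE : JointEnclosuresB1gTP klCertB1gTPm03D0125 klCertB1gTPm03D0125JRows (-3 / 10)) :
    KLB1gDominatesTP (-3 / 10) ((klCertB1gTPm03D0125.mub : ℚ) : ℝ) ((klCertB1gTPm03D0125.mua : ℚ) : ℝ)
      ((klCertB1gTPm03D0125GammaJ : ℚ) : ℝ) :=
  klCertB1gTPm03D0125_dominatesJ_of_HS (fun bx hbx μ hμ =>
    kltp_m03_HS (klCertB1gTPm03D0125_box_mem' bx hbx μ hμ).1 (klCertB1gTPm03D0125_box_mem' bx hbx μ hμ).2) hE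

/-- The `U = 1` form of the JOINT record MODULO (E-J) ONLY. [cite: RaghuKivelsonScalapino2010, §III Fig. 3] -/
theorem klCertB1gTPm03D0125_dominatesAtJ_of_E (hE : JointEnclosuresB1gTP klCertB1gTPm03D0125 klCertB1gTPm03D0125JRows (-3 / 10)) :
    KLB1gDominatesAtTP (-3 / 10) ((klCertB1gTPm03D0125.mub : ℚ) : ℝ) ((klCertB1gTPm03D0125.mua : ℚ) : ℝ)
      ((klCertB1gTPm03D0125GammaJ : ℚ) : ℝ) :=
  klCertB1gTPm03D0125_dominatesAtJ_of_HS (fun bx hbx μ hμ =>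
    kltp_m03_HS (klCertB1gTPm03D0125_box_mem' bx hbx μ hμ).1 (klCertB1gTPm03D0125_box_mem' bx hbx μ hμ).2) hE

end Summit.HubbardSuperconductivity.HubbardSuperconductivity.Theorems

end
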